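import Summits.QuantumFields.YangMills.Theorems.BalabanLadderUVOtherGroupsSUN
import Summits.QuantumFields.YangMills.Theorems.BalabanUVNodesClustersLeaf
import Literature.MathematicalPhysics.QuantumFieldTheory.Balaban1983to89.Node00.Record12
import HarnessLib

/-!
# Route `BalabanLadder`, crux `UVOtherGroups` (stmt-QuantumFields-19356): `UVApexSUN` at Track A's Stage-12 resolution

Helper file (`--supports stmt-QuantumFields-19356`, fleet seat `ym-osasm-p2`, director-ym R136 (iii)); pure theorems.  The `SU(N)` apex piece
of the R85 edit, `UVApexSUN := ∀ N ≥ 3, YMDAG.UVSplit.UVD59 N` (route owner ym-beyond-p2 g20), is Track A's rung-R4 leaf with `SU(2) ↦ SU(N)`.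
The kernels file §5 (`Theorems/BalabanLadderUVOtherGroupsSUN.lean`, `uvD59_of_recordChain`) proved Track A's deciding chain over an ARBITRARY
record predicate whose records are Stage-0 data of record, and pinned it at NODE 00 Stage 11 (`uvD59_of_recordChain₁₁C`).  Track A's def-T
seat has since LOCATED `Provisos₁₁` as uninhabited (K0 misstated; director-ym LINE №87 (3), 2026-08-26) and typed the Stage-12 record
`Node00.IsRecordOfRecord₁₂C` (`Literature/…/Node00/Record12.lean`, with `isDatumOfRecord₀_of_isRecordOfRecord₁₂C`), at which Track A's items
K0–K3 are being re-pinned (rev 8).  This file pins the same chain at Stage 12, for EVERY `N`: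

* `uvD59_of_recordChain₁₂C` — inhabitation of the Stage-12 record class · (B) + window at some Stage-12 record · END given (B) + window ·
  hybrid-NE7 spine given (B) + END ⟹ `YMDAG.UVSplit.UVD59 N`;
* `uv_of_recordChain₁₂C_two` — at `N = 2` the conclusion is the spine's leaf `Theses.BalabanLadder.UV` BY NAME (`uvD59_two_iff`);
* `uvApexSUN_of_recordChain₁₂C` — with `N ≥ 3` ranging: the body of `UVApexSUN`; `uvSUN_of_recordChain₁₂C` — with `N ≥ 2`: `UVSUN`.

So the `SU(N)` apex piece is typable TODAY at Track A's CURRENT resolution: the four Stage-12 statements with `2 ↦ N` (every tree object in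
them — `FiniteEpsData F SU(N)`, `Node00.IsRecordOfRecord₁₂C F N`, `B16.EndStatementBPrinted`, `DagBinding.EndpointExistence`,
`T4ApexHybrid.HybridNE7Under` — is typed at `SU(N)`, `[NeZero N]`).  HONEST FRAMING: the four hypotheses are Bałaban's programme per `SU(N)`
([B4]–[B16]; the `N`-dependence of every constant is unprinted); nothing is discharged; not a gap, not Clay.
-/

set_option autoImplicit false

noncomputable section

open Literature.MathematicalPhysics.QuantumFieldTheory
open Literature.MathematicalPhysics.QuantumFieldTheory.Balaban1983to89
open Literature.MathematicalPhysics.QuantumFieldTheory.Balaban1983to89.T4Continuum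

namespace Summit.QuantumFields.YangMills.Theorems.UVOtherGroups

section Stage12

variable {N : ℕ} [NeZero N]

/-- **Track A's `closes` at `SU(N)`, Stage 12**: the four node statements with `SU(2) ↦ SU(N)` over the Stage-12 record predicate
`Node00.IsRecordOfRecord₁₂C F N` (its records are Stage-0 data of record by `Node00.isDatumOfRecord₀_of_isRecordOfRecord₁₂C`) imply
`YMDAG.UVSplit.UVD59 N` — for EVERY `N` (`uvD59_of_recordChain` pinned at Stage 12). -/
theorem uvD59_of_recordChain₁₂C
    (h0 : ∀ F : T4Family, ∃ (D : FiniteEpsData F (Matrix.specialUnitaryGroup (Fin N) ℂ)) (w : DagBinding.WorldP),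
      Node00.IsRecordOfRecord₁₂C F N D w)
    (h1 : ∀ F : T4Family, (∃ (D : FiniteEpsData F (Matrix.specialUnitaryGroup (Fin N) ℂ)) (w : DagBinding.WorldP),
        Node00.IsRecordOfRecord₁₂C F N D w) →
      ∃ (D : FiniteEpsData F (Matrix.specialUnitaryGroup (Fin N) ℂ)) (w : DagBinding.WorldP), Node00.IsRecordOfRecord₁₂C F N D w ∧
        B16.EndStatementBPrinted D.C ∧ ∃ γ₁ : ℝ, 0 < γ₁ ∧ ∀ γ : ℝ, 0 < γ → γ ≤ γ₁ →
          ∃ P : B12.RunParams, 1 ≤ P.K ∧ (D.C P).flow.InInterval γ P.K)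
    (h2 : ∀ (F : T4Family) (D : FiniteEpsData F (Matrix.specialUnitaryGroup (Fin N) ℂ)) (w : DagBinding.WorldP),
      Node00.IsRecordOfRecord₁₂C F N D w → B16.EndStatementBPrinted D.C → (∃ γ₁ : ℝ, 0 < γ₁ ∧ ∀ γ : ℝ, 0 < γ → γ ≤ γ₁ →
        ∃ P : B12.RunParams, 1 ≤ P.K ∧ (D.C P).flow.InInterval γ P.K) → DagBinding.EndpointExistence D.C.toB12)
    (h3 : ∀ (F : T4Family) (D : FiniteEpsData F (Matrix.specialUnitaryGroup (Fin N) ℂ)) (w : DagBinding.WorldP),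
      Node00.IsRecordOfRecord₁₂C F N D w → B16.EndStatementBPrinted D.C → DagBinding.EndpointExistence D.C.toB12 →
        T4ApexHybrid.HybridNE7Under D (DagBinding.EndpointExistence D.C.toB12)) :
    YMDAG.UVSplit.UVD59 N :=
  uvD59_of_recordChain (fun F D w => Node00.IsRecordOfRecord₁₂C F N D w)
    (fun _ _ _ hR => Node00.isDatumOfRecord₀_of_isRecordOfRecord₁₂C hR) h0 h1 h2 h3

end Stage12

/-- **At `N = 2` the Stage-12 chain concludes the spine's leaf `Theses.BalabanLadder.UV` BY NAME** (Track A's tether `uvD59_two_iff`). -/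
theorem uv_of_recordChain₁₂C_two
    (h0 : ∀ F : T4Family, ∃ (D : FiniteEpsData F (Matrix.specialUnitaryGroup (Fin 2) ℂ)) (w : DagBinding.WorldP),
      Node00.IsRecordOfRecord₁₂C F 2 D w)
    (h1 : ∀ F : T4Family, (∃ (D : FiniteEpsData F (Matrix.specialUnitaryGroup (Fin 2) ℂ)) (w : DagBinding.WorldP),
        Node00.IsRecordOfRecord₁₂C F 2 D w) →
      ∃ (D : FiniteEpsData F (Matrix.specialUnitaryGroup (Fin 2) ℂ)) (w : DagBinding.WorldP), Node00.IsRecordOfRecord₁₂C F 2 D w ∧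
        B16.EndStatementBPrinted D.C ∧ ∃ γ₁ : ℝ, 0 < γ₁ ∧ ∀ γ : ℝ, 0 < γ → γ ≤ γ₁ →
          ∃ P : B12.RunParams, 1 ≤ P.K ∧ (D.C P).flow.InInterval γ P.K)
    (h2 : ∀ (F : T4Family) (D : FiniteEpsData F (Matrix.specialUnitaryGroup (Fin 2) ℂ)) (w : DagBinding.WorldP),
      Node00.IsRecordOfRecord₁₂C F 2 D w → B16.EndStatementBPrinted D.C → (∃ γ₁ : ℝ, 0 < γ₁ ∧ ∀ γ : ℝ, 0 < γ → γ ≤ γ₁ →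
        ∃ P : B12.RunParams, 1 ≤ P.K ∧ (D.C P).flow.InInterval γ P.K) → DagBinding.EndpointExistence D.C.toB12)
    (h3 : ∀ (F : T4Family) (D : FiniteEpsData F (Matrix.specialUnitaryGroup (Fin 2) ℂ)) (w : DagBinding.WorldP),
      Node00.IsRecordOfRecord₁₂C F 2 D w → B16.EndStatementBPrinted D.C → DagBinding.EndpointExistence D.C.toB12 →
        T4ApexHybrid.HybridNE7Under D (DagBinding.EndpointExistence D.C.toB12)) :
    Summit.QuantumFields.YangMills.Theses.BalabanLadder.UV :=
  YMDAG.UVSplit.uvD59_two_iff.1 (uvD59_of_recordChain₁₂C h0 h1 h2 h3)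

/-- **The R85 piece `UVApexSUN` from the Stage-12 chain for every `N ≥ 3`**: the four node statements with `SU(2) ↦ SU(N)`, for all
`N ≥ 3`, give `∀ N ≥ 3, YMDAG.UVSplit.UVD59 N` (the body of the edit's `UVApexSUN`). -/
theorem uvApexSUN_of_recordChain₁₂C
    (h0 : ∀ (N : ℕ) [NeZero N], 3 ≤ N → ∀ F : T4Family,
      ∃ (D : FiniteEpsData F (Matrix.specialUnitaryGroup (Fin N) ℂ)) (w : DagBinding.WorldP), Node00.IsRecordOfRecord₁₂C F N D w)
    (h1 : ∀ (N : ℕ) [NeZero N], 3 ≤ N → ∀ F : T4Family,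
      (∃ (D : FiniteEpsData F (Matrix.specialUnitaryGroup (Fin N) ℂ)) (w : DagBinding.WorldP), Node00.IsRecordOfRecord₁₂C F N D w) →
      ∃ (D : FiniteEpsData F (Matrix.specialUnitaryGroup (Fin N) ℂ)) (w : DagBinding.WorldP), Node00.IsRecordOfRecord₁₂C F N D w ∧
        B16.EndStatementBPrinted D.C ∧ ∃ γ₁ : ℝ, 0 < γ₁ ∧ ∀ γ : ℝ, 0 < γ → γ ≤ γ₁ →
          ∃ P : B12.RunParams, 1 ≤ P.K ∧ (D.C P).flow.InInterval γ P.K)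
    (h2 : ∀ (N : ℕ) [NeZero N], 3 ≤ N → ∀ (F : T4Family) (D : FiniteEpsData F (Matrix.specialUnitaryGroup (Fin N) ℂ))
      (w : DagBinding.WorldP), Node00.IsRecordOfRecord₁₂C F N D w → B16.EndStatementBPrinted D.C →
      (∃ γ₁ : ℝ, 0 < γ₁ ∧ ∀ γ : ℝ, 0 < γ → γ ≤ γ₁ → ∃ P : B12.RunParams, 1 ≤ P.K ∧ (D.C P).flow.InInterval γ P.K) →
      DagBinding.EndpointExistence D.C.toB12)
    (h3 : ∀ (N : ℕ) [NeZero N], 3 ≤ N → ∀ (F : T4Family) (D : FiniteEpsData F (Matrix.specialUnitaryGroup (Fin N) ℂ))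
      (w : DagBinding.WorldP), Node00.IsRecordOfRecord₁₂C F N D w → B16.EndStatementBPrinted D.C →
      DagBinding.EndpointExistence D.C.toB12 → T4ApexHybrid.HybridNE7Under D (DagBinding.EndpointExistence D.C.toB12)) :
    ∀ (N : ℕ) [NeZero N], 3 ≤ N → YMDAG.UVSplit.UVD59 N :=
  fun N _ hN => uvD59_of_recordChain₁₂C (h0 N hN) (h1 N hN) (h2 N hN) (h3 N hN)

/-- **`UVSUN` from the Stage-12 chain for every `N ≥ 2`** (the `N = 2` instance is the spine's `UV`, `uv_of_uvSUN`). -/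
theorem uvSUN_of_recordChain₁₂C
    (h0 : ∀ (N : ℕ) [NeZero N], 2 ≤ N → ∀ F : T4Family,
      ∃ (D : FiniteEpsData F (Matrix.specialUnitaryGroup (Fin N) ℂ)) (w : DagBinding.WorldP), Node00.IsRecordOfRecord₁₂C F N D w)
    (h1 : ∀ (N : ℕ) [NeZero N], 2 ≤ N → ∀ F : T4Family,
      (∃ (D : FiniteEpsData F (Matrix.specialUnitaryGroup (Fin N) ℂ)) (w : DagBinding.WorldP), Node00.IsRecordOfRecord₁₂C F N D w) →
      ∃ (D : FiniteEpsData F (Matrix.specialUnitaryGroup (Fin N) ℂ)) (w : DagBinding.WorldP), Node00.IsRecordOfRecord₁₂C F N D w ∧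
        B16.EndStatementBPrinted D.C ∧ ∃ γ₁ : ℝ, 0 < γ₁ ∧ ∀ γ : ℝ, 0 < γ → γ ≤ γ₁ →
          ∃ P : B12.RunParams, 1 ≤ P.K ∧ (D.C P).flow.InInterval γ P.K)
    (h2 : ∀ (N : ℕ) [NeZero N], 2 ≤ N → ∀ (F : T4Family) (D : FiniteEpsData F (Matrix.specialUnitaryGroup (Fin N) ℂ))
      (w : DagBinding.WorldP), Node00.IsRecordOfRecord₁₂C F N D w → B16.EndStatementBPrinted D.C →
      (∃ γ₁ : ℝ, 0 < γ₁ ∧ ∀ γ : ℝ, 0 < γ → γ ≤ γ₁ → ∃ P : B12.RunParams, 1 ≤ P.K ∧ (D.C P).flow.InInterval γ P.K) →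
      DagBinding.EndpointExistence D.C.toB12)
    (h3 : ∀ (N : ℕ) [NeZero N], 2 ≤ N → ∀ (F : T4Family) (D : FiniteEpsData F (Matrix.specialUnitaryGroup (Fin N) ℂ))
      (w : DagBinding.WorldP), Node00.IsRecordOfRecord₁₂C F N D w → B16.EndStatementBPrinted D.C →
      DagBinding.EndpointExistence D.C.toB12 → T4ApexHybrid.HybridNE7Under D (DagBinding.EndpointExistence D.C.toB12)) :
    UVSUN :=
  fun N _ hN => uvD59_of_recordChain₁₂C (h0 N hN) (h1 N hN) (h2 N hN) (h3 N hN)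

end Summit.QuantumFields.YangMills.Theorems.UVOtherGroups

end
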